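import Mathlib
import HarnessLib
import Literature.NumberTheory.LFunctions.HorocyclePhaseTwoStep

/-!
# The `t`-weighted phase integral `∫ e(kX(t)) t G(Y(t)) dt`, uniformly in the diameter

Support file (all statements PROVED, no definitions, no named facts) for the elementary proof of
the conditional rate of equidistribution of closed horocycles
(`Literature.NumberTheory.LFunctions.horocycleRate_of_quasiRH`; Zagier 1981 §1 p. 279, Sarnak 1981
Thm. 1), continuing `HorocyclePhaseTwoStep.lean`. Differentiating the Fourier coefficient
`b_k(w) = ∫ e(kX_w(t)) g_k(Y_w(t)) dt` of the horocycle integral in the diameter parameter `w`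
produces the weighted phase integral `∫ e(kX_w(t)) t G(Y_w(t)) dt` (with `G(h) = h g_k(h)`), whose
amplitude is of size `t ≍ w^{-1/2}` on the support. This file bounds it uniformly in `w`:

* `norm_branch_integral_mul_le` — on a branch `[√2, √(1/(wa))]`, `w ≤ 1/(3b)`:
  `≤ 75(2S₀ + 12bS₁ + 4b²S₂)/(κ²a²)` for `G ∈ C²` with `‖G‖ ≤ S₀, ‖G'‖ ≤ S₁, ‖G''‖ ≤ S₂`
  supported in `(a,b)` (`norm_branch_integral_le_two` with `A = tG(Y)`; `|Y'| ≤ 2Y/t`,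
  `|Y''| ≤ 6Y/t²`);
* `norm_phase_integral_mul_le_of_le` — the full line for `w ≤ 1/(3b)` (two branches, the arc
  `t² ≤ 2` lies above the strip): `≤ 150(2S₀ + 12bS₁ + 4b²S₂)/((2πk)²a²)`;
* `norm_phase_integral_mul_le_of_ge` — `w ≥ 1/(3b)`: the trivial bound `6bS₀/a`;
* `continuous_phase_integrand_mul`, `phase_integral_mul_eq_intervalIntegral` — bookkeeping.

## References
* H. Iwaniec, *Spectral Methods of Automorphic Forms*, 2nd ed., AMS GSM 53 (2002), §3.4
  [Iwaniec2002].
* P. Sarnak, *Asymptotic behavior of periodic orbits of the horocycle flow and Eisenstein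
  series*, Comm. Pure Appl. Math. 34 (1981), 719–739, Thm. 1 [Sarnak1981].

## Mathlib / tree search
Tree: `HorocyclePhase.norm_branch_integral_le_two`, `hasDerivAt_Y'`, `abs_Y'_le`, `abs_Y''_le`
(`HorocyclePhaseTwoStep.lean`), `hasDerivAt_Y`, `abs_lt_sqrt_of_apply_Y_ne_zero`,
`continuous_phase_integrand`, `norm_phase_integral_le_of_le` (the unweighted template).
-/

noncomputable section


open Complex MeasureTheory Set Filter Topology intervalIntegral
open scoped Real ContDiff

namespace Literature.NumberTheory.LFunctions

namespace HorocyclePhase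

/-- **Two-step branch estimate for the `t`-weighted amplitude.** Let `0 < a ≤ b`,
`0 < w ≤ 1/(3b)`, `κ ≠ 0`, and let `G` be `C²` (`G' = G₁`, `G₁' = G₂`, `G₂` continuous) with
`‖G‖ ≤ S₀`, `‖G₁‖ ≤ S₁`, `‖G₂‖ ≤ S₂`, all three supported in `(a, b)`. Then
`‖∫_{√2}^{√(1/(wa))} exp(iκX(t)) t G(Y(t)) dt‖ ≤ 75 (2S₀ + 12 b S₁ + 4 b² S₂)/(κ² a²)`
(`norm_branch_integral_le_two` with `A = t G(Y)`: `‖A‖ ≤ S₀ t`, `‖A'‖ ≤ S₀ + 2bS₁`,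
`t‖A''‖ ≤ 10bS₁ + 4b²S₂`, using `|Y'| ≤ 2Y/t`, `|Y''| ≤ 6Y/t²` and `Y < b` on the support).
[folklore] -/
theorem norm_branch_integral_mul_le {a b w κ S₀ S₁ S₂ : ℝ} {G G₁ G₂ : ℝ → ℂ} (ha : 0 < a)
    (hab : a ≤ b) (hw : 0 < w) (hwb : w ≤ 1 / (3 * b)) (hκ : κ ≠ 0)
    (hG : ∀ h, HasDerivAt G (G₁ h) h) (hG₁ : ∀ h, HasDerivAt G₁ (G₂ h) h) (hG₂c : Continuous G₂)
    (hS₀ : ∀ h, ‖G h‖ ≤ S₀) (hS₁ : ∀ h, ‖G₁ h‖ ≤ S₁) (hS₂ : ∀ h, ‖G₂ h‖ ≤ S₂)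
    (hGs : ∀ h, G h ≠ 0 → a < h ∧ h < b) (hG₁s : ∀ h, G₁ h ≠ 0 → a < h ∧ h < b)
    (hG₂s : ∀ h, G₂ h ≠ 0 → a < h ∧ h < b) :
    ‖∫ t in Real.sqrt 2..Real.sqrt (1 / (w * a)),
        Complex.exp (I * κ * (-t / (w * (1 + t ^ 2)) : ℝ)) *
          ((t : ℂ) * G (1 / (w * (1 + t ^ 2))))‖ ≤
      75 * (2 * S₀ + 12 * b * S₁ + 4 * b ^ 2 * S₂) / (κ ^ 2 * a ^ 2) := by
  have hb : 0 < b := lt_of_lt_of_le ha hab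
  have hS₀0 : 0 ≤ S₀ := le_trans (norm_nonneg _) (hS₀ 0)
  have hS₁0 : 0 ≤ S₁ := le_trans (norm_nonneg _) (hS₁ 0)
  have hS₂0 : 0 ≤ S₂ := le_trans (norm_nonneg _) (hS₂ 0)
  have hGc : Continuous G := continuous_iff_continuousAt.2 fun h => (hG h).continuousAt
  have hG₁c : Continuous G₁ := continuous_iff_continuousAt.2 fun h => (hG₁ h).continuousAt
  have hwa : w * a ≤ 1 / 3 := by
    calc w * a ≤ 1 / (3 * b) * b := mul_le_mul hwb hab ha.le (by positivity)
      _ = 1 / 3 := by field_simp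
  set T : ℝ := Real.sqrt (1 / (w * a)) with hT
  have hT2 : T ^ 2 = 1 / (w * a) := Real.sq_sqrt (by positivity)
  have hwb3 : 3 ≤ 1 / (w * b) := by
    rw [le_div_iff₀ (mul_pos hw hb)]
    calc 3 * (w * b) = w * (3 * b) := by ring
      _ ≤ 1 / (3 * b) * (3 * b) := by gcongr
      _ = 1 := by field_simp
  have hwa3 : 3 ≤ 1 / (w * a) := le_trans hwb3 (by gcongr)
  have h2T : Real.sqrt 2 ≤ T := Real.sqrt_le_sqrt (by linarith)
  have hs2 : Real.sqrt 2 ^ 2 = 2 := Real.sq_sqrt (by norm_num)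
  have hs2pos : 0 < Real.sqrt 2 := Real.sqrt_pos.mpr (by norm_num)
  have hI : ∀ t ∈ Set.uIcc (Real.sqrt 2) T, 0 < t ∧ 2 ≤ t ^ 2 := by
    intro t ht
    rw [Set.uIcc_of_le h2T, Set.mem_Icc] at ht
    refine ⟨lt_of_lt_of_le hs2pos ht.1, ?_⟩
    calc (2:ℝ) = Real.sqrt 2 ^ 2 := hs2.symm
      _ ≤ t ^ 2 := by gcongr; exact ht.1
  -- the players
  set Y : ℝ → ℝ := fun t => 1 / (w * (1 + t ^ 2)) with hY
  set Y' : ℝ → ℝ := fun t => -2 * t / (w * (1 + t ^ 2) ^ 2) with hY'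
  set Y'' : ℝ → ℝ := fun t => (6 * t ^ 2 - 2) / (w * (1 + t ^ 2) ^ 3) with hY''
  set A : ℝ → ℂ := fun t => (t : ℂ) * G (Y t) with hA
  set A₁ : ℝ → ℂ := fun t => G (Y t) + (t : ℂ) * (G₁ (Y t) * (Y' t : ℝ)) with hA₁
  set A₂ : ℝ → ℂ := fun t => 2 * (G₁ (Y t) * (Y' t : ℝ)) +
    (t : ℂ) * (G₂ (Y t) * (Y' t : ℝ) ^ 2 + G₁ (Y t) * (Y'' t : ℝ)) with hA₂
  -- derivatives
  have hGY : ∀ t, HasDerivAt (fun t => G (Y t)) (G₁ (Y t) * (Y' t : ℝ)) t := by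
    intro t
    have := (hG (Y t)).scomp t (hasDerivAt_Y hw.ne' t)
    refine this.congr_deriv ?_
    rw [Complex.real_smul, mul_comm]
  have hG₁Y : ∀ t, HasDerivAt (fun t => G₁ (Y t)) (G₂ (Y t) * (Y' t : ℝ)) t := by
    intro t
    have := (hG₁ (Y t)).scomp t (hasDerivAt_Y hw.ne' t)
    refine this.congr_deriv ?_
    rw [Complex.real_smul, mul_comm]
  have hY'd : ∀ t, HasDerivAt (fun t => ((Y' t : ℝ) : ℂ)) ((Y'' t : ℝ) : ℂ) t := fun t =>
    (hasDerivAt_Y' hw.ne' t).ofReal_comp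
  have htd : ∀ t : ℝ, HasDerivAt (fun t : ℝ => (t : ℂ)) 1 t := fun t => Complex.ofRealCLM.hasDerivAt
  have hAd : ∀ t ∈ Set.uIcc (Real.sqrt 2) T, HasDerivAt A (A₁ t) t := by
    intro t _
    have key := (htd t).fun_mul (hGY t)
    have e : (1 : ℂ) * G (Y t) + (t : ℂ) * (G₁ (Y t) * (Y' t : ℝ)) = A₁ t := by
      simp only [hA₁]; ring
    rw [e] at key
    exact key
  have hA₁d : ∀ t ∈ Set.uIcc (Real.sqrt 2) T, HasDerivAt A₁ (A₂ t) t := by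
    intro t _
    have h2 := (htd t).fun_mul ((hG₁Y t).fun_mul (hY'd t))
    have key := (hGY t).fun_add h2
    have e : G₁ (Y t) * (Y' t : ℝ) + ((1 : ℂ) * (G₁ (Y t) * (Y' t : ℝ)) +
        (t : ℂ) * (G₂ (Y t) * (Y' t : ℝ) * (Y' t : ℝ) + G₁ (Y t) * (Y'' t : ℝ))) = A₂ t := by
      simp only [hA₂]; ring
    rw [e] at key
    exact key
  have hYc : Continuous Y := by
    simp only [hY]; exact continuous_const.div (by fun_prop) fun t => by positivity
  have hY'c : Continuous Y' := by
    simp only [hY']; exact Continuous.div (by fun_prop) (by fun_prop) fun t => by positivity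
  have hY''c : Continuous Y'' := by
    simp only [hY'']; exact Continuous.div (by fun_prop) (by fun_prop) fun t => by positivity
  have hA₂c : ContinuousOn A₂ (Set.uIcc (Real.sqrt 2) T) := by
    apply Continuous.continuousOn
    simp only [hA₂]
    refine Continuous.add (continuous_const.mul ((hG₁c.comp hYc).mul
      (continuous_ofReal.comp hY'c))) (continuous_ofReal.mul (Continuous.add ?_ ?_))
    · exact (hG₂c.comp hYc).mul ((continuous_ofReal.comp hY'c).pow 2)
    · exact (hG₁c.comp hYc).mul (continuous_ofReal.comp hY''c)
  -- heights on the support: `G_i(Y t) ≠ 0 → Y t < b`, and then `|Y'| ≤ 2b/t`, `|Y''| ≤ 6b/t²`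
  have hY'b : ∀ t : ℝ, 0 < t → Y t < b → |Y' t| ≤ 2 * b / t := by
    intro t ht hYt
    refine (abs_Y'_le hw ht).trans ?_
    rw [div_le_div_iff₀ ht ht]
    have hY0 : 0 ≤ Y t := by simp only [hY]; positivity
    nlinarith
  have hY''b : ∀ t : ℝ, 0 < t → Y t < b → |Y'' t| ≤ 6 * b / t ^ 2 := by
    intro t ht hYt
    refine (abs_Y''_le hw ht.ne').trans ?_
    have ht2 : 0 < t ^ 2 := by positivity
    rw [div_le_div_iff₀ ht2 ht2]
    have hY0 : 0 ≤ Y t := by simp only [hY]; positivity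
    nlinarith
  -- amplitude bounds
  have h0 : ∀ t ∈ Set.uIcc (Real.sqrt 2) T, ‖A t‖ ≤ S₀ * t := by
    intro t ht
    obtain ⟨ht0, -⟩ := hI t ht
    simp only [hA]
    rw [norm_mul, Complex.norm_real, Real.norm_of_nonneg ht0.le, mul_comm]
    exact mul_le_mul_of_nonneg_right (hS₀ _) ht0.le
  have h1 : ∀ t ∈ Set.uIcc (Real.sqrt 2) T, ‖A₁ t‖ ≤ S₀ + 2 * b * S₁ := by
    intro t ht
    obtain ⟨ht0, -⟩ := hI t ht
    simp only [hA₁]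
    refine (norm_add_le _ _).trans (add_le_add (hS₀ _) ?_)
    by_cases hz : G₁ (Y t) = 0
    · rw [hz, zero_mul, mul_zero, norm_zero]; positivity
    · obtain ⟨-, hlt⟩ := hG₁s _ hz
      rw [norm_mul, Complex.norm_real, Real.norm_of_nonneg ht0.le, norm_mul, Complex.norm_real,
        Real.norm_eq_abs]
      calc t * (‖G₁ (Y t)‖ * |Y' t|) ≤ t * (S₁ * (2 * b / t)) := by
            gcongr
            · exact hS₁ _
            · exact hY'b t ht0 hlt
        _ = 2 * b * S₁ := by field_simp
  have h2 : ∀ t ∈ Set.uIcc (Real.sqrt 2) T, t * ‖A₂ t‖ ≤ 10 * b * S₁ + 4 * b ^ 2 * S₂ := by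
    intro t ht
    obtain ⟨ht0, -⟩ := hI t ht
    simp only [hA₂]
    have e1 : ‖2 * (G₁ (Y t) * (Y' t : ℝ))‖ ≤ 2 * (S₁ * (2 * b / t)) := by
      by_cases hz : G₁ (Y t) = 0
      · rw [hz, zero_mul, mul_zero, norm_zero]; positivity
      · obtain ⟨-, hlt⟩ := hG₁s _ hz
        rw [norm_mul, Complex.norm_two, norm_mul, Complex.norm_real, Real.norm_eq_abs]
        gcongr
        · exact hS₁ _
        · exact hY'b t ht0 hlt
    have e2 : ‖G₂ (Y t) * (Y' t : ℝ) ^ 2‖ ≤ S₂ * (2 * b / t) ^ 2 := by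
      by_cases hz : G₂ (Y t) = 0
      · rw [hz, zero_mul, norm_zero]; positivity
      · obtain ⟨-, hlt⟩ := hG₂s _ hz
        rw [norm_mul, norm_pow, Complex.norm_real, Real.norm_eq_abs]
        gcongr
        · exact hS₂ _
        · exact hY'b t ht0 hlt
    have e3 : ‖G₁ (Y t) * (Y'' t : ℝ)‖ ≤ S₁ * (6 * b / t ^ 2) := by
      by_cases hz : G₁ (Y t) = 0
      · rw [hz, zero_mul, norm_zero]; positivity
      · obtain ⟨-, hlt⟩ := hG₁s _ hz
        rw [norm_mul, Complex.norm_real, Real.norm_eq_abs]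
        gcongr
        · exact hS₁ _
        · exact hY''b t ht0 hlt
    calc t * ‖2 * (G₁ (Y t) * (Y' t : ℝ)) +
          (t : ℂ) * (G₂ (Y t) * (Y' t : ℝ) ^ 2 + G₁ (Y t) * (Y'' t : ℝ))‖
        ≤ t * (‖2 * (G₁ (Y t) * (Y' t : ℝ))‖ +
            t * (‖G₂ (Y t) * (Y' t : ℝ) ^ 2‖ + ‖G₁ (Y t) * (Y'' t : ℝ)‖)) := by
          refine mul_le_mul_of_nonneg_left ((norm_add_le _ _).trans (add_le_add le_rfl ?_)) ht0.le
          rw [norm_mul, Complex.norm_real, Real.norm_of_nonneg ht0.le]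
          exact mul_le_mul_of_nonneg_left (norm_add_le _ _) ht0.le
      _ ≤ t * (2 * (S₁ * (2 * b / t)) + t * (S₂ * (2 * b / t) ^ 2 + S₁ * (6 * b / t ^ 2))) := by
          gcongr
      _ = 10 * b * S₁ + 4 * b ^ 2 * S₂ := by
          field_simp
          ring
  -- vanishing at the endpoints
  have hYT : Y T < a := by
    simp only [hY]
    rw [hT2, div_lt_iff₀ (by positivity)]
    have : w * (1 + 1 / (w * a)) = w + 1 / a := by field_simp
    rw [this]
    have : a * (1 / a) = 1 := by field_simp
    nlinarith
  have hY2 : b ≤ Y (Real.sqrt 2) := by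
    simp only [hY]
    rw [hs2, le_div_iff₀ (by positivity)]
    rw [le_div_iff₀ (by positivity)] at hwb3
    linarith
  have hGT : G (Y T) = 0 := by
    by_contra h; exact absurd (hGs _ h).1 (not_lt.mpr hYT.le)
  have hG2 : G (Y (Real.sqrt 2)) = 0 := by
    by_contra h; exact absurd (hGs _ h).2 (not_lt.mpr hY2)
  have hG₁T : G₁ (Y T) = 0 := by
    by_contra h; exact absurd (hG₁s _ h).1 (not_lt.mpr hYT.le)
  have hG₁2 : G₁ (Y (Real.sqrt 2)) = 0 := by
    by_contra h; exact absurd (hG₁s _ h).2 (not_lt.mpr hY2)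
  have hA2 : A (Real.sqrt 2) = 0 := by simp only [hA, hG2, mul_zero]
  have hAT : A T = 0 := by simp only [hA, hGT, mul_zero]
  have hA₁2 : A₁ (Real.sqrt 2) = 0 := by simp only [hA₁, hG2, hG₁2, zero_mul, mul_zero, add_zero]
  have hA₁T : A₁ T = 0 := by simp only [hA₁, hGT, hG₁T, zero_mul, mul_zero, add_zero]
  have h := norm_branch_integral_le_two (A := A) (A₁ := A₁) (A₂ := A₂) ha hw hwa hκ hAd hA₁d hA₂c
    h0 h1 h2 hS₀0 (by positivity) (by positivity) hA2 hAT hA₁2 hA₁T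
  have e : S₀ + (S₀ + 2 * b * S₁) + (10 * b * S₁ + 4 * b ^ 2 * S₂) =
      2 * S₀ + 12 * b * S₁ + 4 * b ^ 2 * S₂ := by ring
  rw [e] at h
  simpa only [hA, hY] using h


/-! ### The full `t`-weighted phase integral -/

/-- Continuity of the weighted phase integrand. [folklore] -/
theorem continuous_phase_integrand_mul {w : ℝ} (hw : w ≠ 0) (k : ℤ) {G : ℝ → ℂ}
    (hGc : Continuous G) :
    Continuous fun t : ℝ => Complex.exp (2 * π * I * k * (-t / (w * (1 + t ^ 2)))) *
      ((t : ℂ) * G (1 / (w * (1 + t ^ 2)))) := by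
  have h := continuous_phase_integrand hw k hGc
  have e : (fun t : ℝ => Complex.exp (2 * π * I * k * (-t / (w * (1 + t ^ 2)))) *
      ((t : ℂ) * G (1 / (w * (1 + t ^ 2))))) = fun t : ℝ => (t : ℂ) *
      (Complex.exp (2 * π * I * k * (-t / (w * (1 + t ^ 2)))) * G (1 / (w * (1 + t ^ 2)))) := by
    funext t; ring
  rw [e]
  exact continuous_ofReal.mul h

/-- The weighted phase integral lives on `[-√(1/(wa)), √(1/(wa))]`. [folklore] -/
theorem phase_integral_mul_eq_intervalIntegral {a b w : ℝ} (ha : 0 < a) (hw : 0 < w) (k : ℤ)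
    {G : ℝ → ℂ} (hGs : ∀ h, G h ≠ 0 → a < h ∧ h < b) :
    ∫ t : ℝ, Complex.exp (2 * π * I * k * (-t / (w * (1 + t ^ 2)))) *
        ((t : ℂ) * G (1 / (w * (1 + t ^ 2)))) =
      ∫ t in (-Real.sqrt (1 / (w * a)))..Real.sqrt (1 / (w * a)),
        Complex.exp (2 * π * I * k * (-t / (w * (1 + t ^ 2)))) *
          ((t : ℂ) * G (1 / (w * (1 + t ^ 2)))) := by
  symm
  apply intervalIntegral.integral_eq_integral_of_support_subset
  intro t ht
  rw [Function.mem_support] at ht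
  have hG : G (1 / (w * (1 + t ^ 2))) ≠ 0 := fun h => ht (by rw [h, mul_zero, mul_zero])
  have := abs_lt_sqrt_of_apply_Y_ne_zero ha hw hGs hG
  rw [abs_lt] at this
  exact ⟨this.1, this.2.le⟩

/-- **Weighted phase integral, small diameter** (`0 < w ≤ 1/(3b)`): both branches `|t| ≥ √2`
by `norm_branch_integral_mul_le` (two integrations by parts), the arc `t² ≤ 2` lying above the
strip: `‖∫_ℝ e(kX(t)) t G(Y(t)) dt‖ ≤ 150 (2S₀ + 12bS₁ + 4b²S₂)/((2πk)² a²)` — uniformly in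
`w`. [folklore] -/
theorem norm_phase_integral_mul_le_of_le {a b w S₀ S₁ S₂ : ℝ} {k : ℤ} {G G₁ G₂ : ℝ → ℂ}
    (ha : 0 < a) (hab : a ≤ b) (hw : 0 < w) (hwb : w ≤ 1 / (3 * b)) (hk : k ≠ 0)
    (hG : ∀ h, HasDerivAt G (G₁ h) h) (hG₁ : ∀ h, HasDerivAt G₁ (G₂ h) h) (hG₂c : Continuous G₂)
    (hS₀ : ∀ h, ‖G h‖ ≤ S₀) (hS₁ : ∀ h, ‖G₁ h‖ ≤ S₁) (hS₂ : ∀ h, ‖G₂ h‖ ≤ S₂)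
    (hGs : ∀ h, G h ≠ 0 → a < h ∧ h < b) (hG₁s : ∀ h, G₁ h ≠ 0 → a < h ∧ h < b)
    (hG₂s : ∀ h, G₂ h ≠ 0 → a < h ∧ h < b) :
    ‖∫ t : ℝ, Complex.exp (2 * π * I * k * (-t / (w * (1 + t ^ 2)))) *
        ((t : ℂ) * G (1 / (w * (1 + t ^ 2))))‖ ≤
      150 * (2 * S₀ + 12 * b * S₁ + 4 * b ^ 2 * S₂) / ((2 * π * (k : ℝ)) ^ 2 * a ^ 2) := by
  have hb : 0 < b := lt_of_lt_of_le ha hab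
  have hGc : Continuous G := continuous_iff_continuousAt.2 fun h => (hG h).continuousAt
  set T : ℝ := Real.sqrt (1 / (w * a)) with hT
  set Φ : ℝ → ℂ := fun t => Complex.exp (2 * π * I * k * (-t / (w * (1 + t ^ 2)))) *
    ((t : ℂ) * G (1 / (w * (1 + t ^ 2)))) with hΦ
  have hΦc : Continuous Φ := continuous_phase_integrand_mul hw.ne' k hGc
  have hwb3 : 3 ≤ 1 / (w * b) := by
    rw [le_div_iff₀ (mul_pos hw hb)]
    calc 3 * (w * b) = w * (3 * b) := by ring
      _ ≤ 1 / (3 * b) * (3 * b) := by gcongr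
      _ = 1 := by field_simp
  have hwa3 : 3 ≤ 1 / (w * a) := le_trans hwb3 (by gcongr)
  have h2T : Real.sqrt 2 ≤ T := Real.sqrt_le_sqrt (by linarith)
  have hs2 : Real.sqrt 2 ^ 2 = 2 := Real.sq_sqrt (by norm_num)
  rw [phase_integral_mul_eq_intervalIntegral ha hw k hGs]
  change ‖∫ t in (-T)..T, Φ t‖ ≤ _
  have hsplit : ∫ t in (-T)..T, Φ t = (∫ t in (-T)..(-Real.sqrt 2), Φ t) +
      (∫ t in (-Real.sqrt 2)..Real.sqrt 2, Φ t) + ∫ t in Real.sqrt 2..T, Φ t := by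
    rw [intervalIntegral.integral_add_adjacent_intervals (hΦc.intervalIntegrable _ _)
      (hΦc.intervalIntegrable _ _), intervalIntegral.integral_add_adjacent_intervals
      (hΦc.intervalIntegrable _ _) (hΦc.intervalIntegrable _ _)]
  -- the middle arc vanishes
  have hmid : ∫ t in (-Real.sqrt 2)..Real.sqrt 2, Φ t = 0 := by
    rw [intervalIntegral.integral_congr (g := fun _ => (0:ℂ)) fun t ht => ?_]
    · simp
    · rw [Set.uIcc_of_le (by linarith [Real.sqrt_nonneg 2]), Set.mem_Icc, ← abs_le] at ht
      have ht2 : t ^ 2 ≤ 2 := by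
        calc t ^ 2 = |t| ^ 2 := (sq_abs t).symm
          _ ≤ Real.sqrt 2 ^ 2 := by gcongr
          _ = 2 := hs2
      have hYb : b ≤ 1 / (w * (1 + t ^ 2)) := by
        rw [le_div_iff₀ (by positivity)]
        rw [le_div_iff₀ (by positivity)] at hwb3
        nlinarith
      simp only [hΦ]
      have : G (1 / (w * (1 + t ^ 2))) = 0 := by
        by_contra h; exact absurd (hGs _ h).2 (not_lt.mpr hYb)
      rw [this, mul_zero, mul_zero]
  -- the left branch is minus the right branch with the opposite phase
  have hleft : ∫ t in (-T)..(-Real.sqrt 2), Φ t = -∫ s in Real.sqrt 2..T,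
      Complex.exp (I * ((-(2 * π * k) : ℝ)) * (-s / (w * (1 + s ^ 2)) : ℝ)) *
        ((s : ℂ) * G (1 / (w * (1 + s ^ 2)))) := by
    rw [← intervalIntegral.integral_comp_neg, ← intervalIntegral.integral_neg]
    refine intervalIntegral.integral_congr fun s _ => ?_
    simp only [hΦ]
    have hs : (1 + (-s) ^ 2 : ℝ) = 1 + s ^ 2 := by ring
    rw [hs]
    have e1 : Complex.exp (2 * π * I * k * (-((-s : ℝ) : ℂ) / (w * (1 + ((-s : ℝ) : ℂ) ^ 2)))) =
        Complex.exp (I * ((-(2 * π * k) : ℝ)) * (-s / (w * (1 + s ^ 2)) : ℝ)) := by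
      congr 1; push_cast; ring
    rw [e1]
    push_cast
    ring
  have hright : ∫ t in Real.sqrt 2..T, Φ t = ∫ s in Real.sqrt 2..T,
      Complex.exp (I * ((2 * π * k : ℝ)) * (-s / (w * (1 + s ^ 2)) : ℝ)) *
        ((s : ℂ) * G (1 / (w * (1 + s ^ 2)))) := by
    refine intervalIntegral.integral_congr fun s _ => ?_
    simp only [hΦ]
    congr 2; push_cast; ring
  have hκ : (2 * π * k : ℝ) ≠ 0 := by
    simp [Real.pi_ne_zero, hk]
  have hκ' : (-(2 * π * k) : ℝ) ≠ 0 := neg_ne_zero.mpr hκ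
  have hb1 := norm_branch_integral_mul_le ha hab hw hwb hκ hG hG₁ hG₂c hS₀ hS₁ hS₂ hGs hG₁s hG₂s
  have hb2 := norm_branch_integral_mul_le ha hab hw hwb hκ' hG hG₁ hG₂c hS₀ hS₁ hS₂ hGs hG₁s hG₂s
  rw [hsplit, hmid, add_zero, hleft, hright]
  refine (norm_add_le _ _).trans ?_
  rw [norm_neg]
  rw [neg_sq] at hb2
  have e : ((2 * π * k : ℝ)) ^ 2 = (2 * π * (k : ℝ)) ^ 2 := by norm_cast
  calc _ ≤ 75 * (2 * S₀ + 12 * b * S₁ + 4 * b ^ 2 * S₂) / ((2 * π * (k : ℝ)) ^ 2 * a ^ 2) +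
        75 * (2 * S₀ + 12 * b * S₁ + 4 * b ^ 2 * S₂) / ((2 * π * (k : ℝ)) ^ 2 * a ^ 2) :=
        add_le_add hb2 hb1
    _ = 150 * (2 * S₀ + 12 * b * S₁ + 4 * b ^ 2 * S₂) / ((2 * π * (k : ℝ)) ^ 2 * a ^ 2) := by ring

/-- **Weighted phase integral, large diameter** (`w ≥ 1/(3b)`): the trivial bound over the
support, `‖∫_ℝ e(kX(t)) t G(Y(t)) dt‖ ≤ 6 b S₀ / a`. [folklore] -/
theorem norm_phase_integral_mul_le_of_ge {a b w S₀ : ℝ} (k : ℤ) {G : ℝ → ℂ} (ha : 0 < a)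
    (hab : a ≤ b) (hw : 0 < w) (hwb : 1 / (3 * b) ≤ w) (hS₀ : ∀ h, ‖G h‖ ≤ S₀)
    (hGs : ∀ h, G h ≠ 0 → a < h ∧ h < b) :
    ‖∫ t : ℝ, Complex.exp (2 * π * I * k * (-t / (w * (1 + t ^ 2)))) *
        ((t : ℂ) * G (1 / (w * (1 + t ^ 2))))‖ ≤ 6 * b * S₀ / a := by
  have hb : 0 < b := lt_of_lt_of_le ha hab
  have hS₀0 : 0 ≤ S₀ := le_trans (norm_nonneg _) (hS₀ 0)
  set T : ℝ := Real.sqrt (1 / (w * a)) with hT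
  have hT0 : 0 ≤ T := Real.sqrt_nonneg _
  have hT2 : T ^ 2 = 1 / (w * a) := Real.sq_sqrt (by positivity)
  have hT2le : T ^ 2 ≤ 3 * b / a := by
    rw [hT2, div_le_div_iff₀ (by positivity) ha]
    have h1 : 1 ≤ 3 * b * w := by
      rw [div_le_iff₀ (by positivity)] at hwb; linarith
    nlinarith
  rw [phase_integral_mul_eq_intervalIntegral ha hw k hGs]
  have hle := intervalIntegral.norm_integral_le_of_norm_le_const (a := -T) (b := T) (C := T * S₀)
    (f := fun t => Complex.exp (2 * π * I * k * (-t / (w * (1 + t ^ 2)))) *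
      ((t : ℂ) * G (1 / (w * (1 + t ^ 2))))) (fun t ht => by
      rw [norm_mul]
      have e : (2 * π * I * k * (-t / (w * (1 + t ^ 2)) : ℂ)) =
          ((2 * π * k * (-t / (w * (1 + t ^ 2))) : ℝ) : ℂ) * I := by push_cast; ring
      rw [e, Complex.norm_exp_ofReal_mul_I, one_mul, norm_mul, Complex.norm_real, Real.norm_eq_abs]
      have hta : |t| ≤ T := by
        rw [Set.uIoc_of_le (by linarith), Set.mem_Ioc] at ht
        exact abs_le.2 ⟨ht.1.le, ht.2⟩
      exact mul_le_mul hta (hS₀ _) (norm_nonneg _) hT0)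
  refine hle.trans ?_
  rw [show T - -T = 2 * T by ring, abs_of_nonneg (by positivity)]
  calc T * S₀ * (2 * T) = 2 * T ^ 2 * S₀ := by ring
    _ ≤ 2 * (3 * b / a) * S₀ := by gcongr
    _ = 6 * b * S₀ / a := by ring

end HorocyclePhase

end Literature.NumberTheory.LFunctions

end
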